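import Mathlib
import Summits.ResolutionOfSingularities.ResolutionOfSingularities.Theorems.WildQuotientsWildQuotientResolutionS1W1NNTwoExit

/-!
# S1 / W1N cascade — Part VII.1–3: coefficient helpers, Nakayama `𝔪² ≤ I ⇒ dim ≤ 2`, and covariance of the cubic cone (`HasTriple`) under shear / swap

Crux stmt-ResolutionOfSingularities-17941 (`WildQuotients.CyclicQuotientFourfolds`), S1a line `s1a-logminvertex`,
stub `stub_W1N_print`, sub-line `w1n-cascade` (idea-1 `W1N-LINE.md`; proofs from `CombinedW1NPrint.scratch.lean`
f33256b0cfc42851).  [OURS · L1 W4.5c] — NOT a statement of the manuscript; counted 0 post-V5.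

The CUBIC CONE `P₃(Q)` = 3-jet of `g = x·b − y·a`; `HasTriple Q` (written INLINE, no new def) :=
`∃ lam u v, lam ≠ 0 ∧ (u ≠ 0 ∨ v ≠ 0) ∧ x·b − y·a − lam·(u x + v y)³ ∈ 𝔪⁴`.  Covariance `hasTriple_shear_iff`,
`hasTriple_swapField_iff` via `substAlgHom` + `Jets.algHom_apply_mem_maximalIdeal_pow`; Nakayama lemmas
`maximalIdeal_sq_le`, `maximalIdeal_sq_le_of_le_sup`, `finrank_quot_le_two_of_sq_le`.
-/

-- single-problem summit: the doubled namespace component `ResolutionOfSingularities` is forced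
set_option linter.dupNamespace false

noncomputable section

open MvPowerSeries IsLocalRing
open Literature.AlgebraicGeometry.Resolution
open Summit.ResolutionOfSingularities.ResolutionOfSingularities.Theorems.WildCones.MuDropCharTwoOrdP

namespace Summit.ResolutionOfSingularities.ResolutionOfSingularities.Theorems.WildQuotientResolution.S1.PlanarField

variable {κ : Type} [Field κ]

/-! ## Part VII — the cubic cone and the support `NStep` [OURS · L1 W4.5c]

At a type-O node `Q` with both orders `≥ 2` the 3-jet of `g = x·b − y·a` is the CUBIC CONE
`P₃(Q) = x·j₂(b) − y·j₂(a)`.  It is covariant under the shear (`P₃ ∘ φ_c`) and the swap (`−P₃ ∘ s`), so the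
property "`P₃(Q)` is `λ·ℓ³` for a `κ`-rational line `ℓ`" — `HasTriple`, written out inline as
`∃ lam u v, lam ≠ 0 ∧ (u ≠ 0 ∨ v ≠ 0) ∧ x·b − y·a − lam·(u x + v y)³ ∈ 𝔪⁴` — is invariant under the B3
transport.  The quantitative O-step: an isolated successor `C` of `Q` has `μ(C) + 2 ≤ μ(Q)` unless `P₃(Q)` is a
cube in the direction of `C`; and the type-N successor `θ₁ = (x·A, G)` has `P₃(θ₁) = x·(b₃₀x² + (b₁₁−2a₂₀)xy − 2βy²)`,
which is a cube only if `2 = 0`, `b₁₁ = 0 ≠ b₃₀`, and then `μ(θ₁) ≤ 4` by Nakayama (`I(A,G) ≤ 2`).  With the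
terminal step S3 (`μ ≤ 4 ⇒ no bad isolated successor`) this proves `NStep`. -/

/-! ### VII.1 Coefficient helpers -/

/-- A series whose coefficients of degree `< N` vanish lies in `𝔪^N` (pair form). [folklore] -/
theorem mem_maximalIdeal_pow_of_coeff_pair {r : MvPowerSeries (Fin 2) κ} (N : ℕ)
    (h : ∀ i j : ℕ, i + j < N → coeff (Finsupp.single 0 i + Finsupp.single 1 j) r = 0) :
    r ∈ maximalIdeal (MvPowerSeries (Fin 2) κ) ^ N := by
  refine Literature.RingTheory.MvPowerSeries.Jets.mem_maximalIdeal_pow_of_coeff_eq_zero fun e he => ?_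
  obtain ⟨i, j, rfl⟩ : ∃ i j : ℕ, e = Finsupp.single 0 i + Finsupp.single 1 j :=
    ⟨e 0, e 1, Literature.NumberTheory.EllipticCurves.finsupp_fin_two_eq e⟩
  rw [map_add, Finsupp.degree_single, Finsupp.degree_single] at he
  exact h i j he

/-- Elements of `𝔪^N` have no coefficients of degree `< N` (pair form). [folklore] -/
theorem coeff_pair_eq_zero_of_mem_maximalIdeal_pow {r : MvPowerSeries (Fin 2) κ} {N : ℕ}
    (h : r ∈ maximalIdeal (MvPowerSeries (Fin 2) κ) ^ N) {i j : ℕ} (hij : i + j < N) :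
    coeff (Finsupp.single 0 i + Finsupp.single 1 j) r = 0 :=
  Literature.RingTheory.MvPowerSeries.Jets.coeff_eq_zero_of_mem_maximalIdeal_pow h
    (by rw [map_add, Finsupp.degree_single, Finsupp.degree_single]; exact hij)

/-- `[x^i y^j] (x^m y^n)`. [folklore] -/
theorem coeff_pair_X_pow_mul_X_pow (i j m n : ℕ) :
    coeff (Finsupp.single 0 i + Finsupp.single 1 j) (X 0 ^ m * X 1 ^ n : MvPowerSeries (Fin 2) κ) =
      if i = m ∧ j = n then 1 else 0 := by
  classical
  rw [X_pow_eq, X_pow_eq, monomial_mul_monomial, one_mul, coeff_monomial]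
  simp only [finTwo_pair_eq_iff]

/-- The cube of a linear form, expanded. [folklore] -/
theorem cube_linear_form (u v : κ) :
    ((C u * X 0 + C v * X 1 : MvPowerSeries (Fin 2) κ) ^ 3) =
      C (u ^ 3) * (X 0 ^ 3 * X 1 ^ 0) + C (3 * u ^ 2 * v) * (X 0 ^ 2 * X 1 ^ 1)
        + C (3 * u * v ^ 2) * (X 0 ^ 1 * X 1 ^ 2) + C (v ^ 3) * (X 0 ^ 0 * X 1 ^ 3) := by
  simp only [map_mul, map_pow, map_ofNat]
  ring

/-- `[x^i y^j] (u x + v y)³`. [folklore] -/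
theorem coeff_pair_cube (u v : κ) (i j : ℕ) :
    coeff (Finsupp.single 0 i + Finsupp.single 1 j) ((C u * X 0 + C v * X 1 : MvPowerSeries (Fin 2) κ) ^ 3) =
      (if i = 3 ∧ j = 0 then u ^ 3 else 0) + (if i = 2 ∧ j = 1 then 3 * u ^ 2 * v else 0)
        + (if i = 1 ∧ j = 2 then 3 * u * v ^ 2 else 0) + (if i = 0 ∧ j = 3 then v ^ 3 else 0) := by
  rw [cube_linear_form]
  simp only [map_add, coeff_C_mul, coeff_pair_X_pow_mul_X_pow, mul_ite, mul_one, mul_zero]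

/-- `[x³] (u x + v y)³ = u³`. [folklore] -/
theorem coeff_cube_three_zero (u v : κ) :
    coeff (Finsupp.single 0 3) ((C u * X 0 + C v * X 1 : MvPowerSeries (Fin 2) κ) ^ 3) = u ^ 3 := by
  have h := coeff_pair_cube u v 3 0
  simpa using h

/-- `[x²y] (u x + v y)³ = 3u²v`. [folklore] -/
theorem coeff_cube_two_one (u v : κ) :
    coeff (Finsupp.single 0 2 + Finsupp.single 1 1) ((C u * X 0 + C v * X 1 : MvPowerSeries (Fin 2) κ) ^ 3) =
      3 * u ^ 2 * v := by
  have h := coeff_pair_cube u v 2 1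
  simpa using h

/-- `[xy²] (u x + v y)³ = 3uv²`. [folklore] -/
theorem coeff_cube_one_two (u v : κ) :
    coeff (Finsupp.single 0 1 + Finsupp.single 1 2) ((C u * X 0 + C v * X 1 : MvPowerSeries (Fin 2) κ) ^ 3) =
      3 * u * v ^ 2 := by
  have h := coeff_pair_cube u v 1 2
  simpa using h

/-- `[y³] (u x + v y)³ = v³`. [folklore] -/
theorem coeff_cube_zero_three (u v : κ) :
    coeff (Finsupp.single 1 3) ((C u * X 0 + C v * X 1 : MvPowerSeries (Fin 2) κ) ^ 3) = v ^ 3 := by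
  have h := coeff_pair_cube u v 0 3
  simpa using h

/-- `[x²] (u x + v y)³ = 0`. [folklore] -/
theorem coeff_cube_two_zero (u v : κ) :
    coeff (Finsupp.single 0 2) ((C u * X 0 + C v * X 1 : MvPowerSeries (Fin 2) κ) ^ 3) = 0 := by
  have h := coeff_pair_cube u v 2 0
  simpa using h

/-- More coefficients of `g = x·b − y·a`: `g₂₁ = b₁₁ − a₂₀`, `g₁₂ = b₀₂ − a₁₁`, `g₀₃ = −a₀₂`, `g₄₀ = b₃₀`.
[folklore] -/
theorem coeff_g_two_one (θ : PlanarField κ) :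
    coeff (Finsupp.single 0 2 + Finsupp.single 1 1) (X 0 * θ.b - X 1 * θ.a) =
      coeff (Finsupp.single 0 1 + Finsupp.single 1 1) θ.b - coeff (Finsupp.single 0 2) θ.a := by
  have e1 : (Finsupp.single 0 2 + Finsupp.single 1 1 : Fin 2 →₀ ℕ) =
      Finsupp.single 0 1 + (Finsupp.single 0 1 + Finsupp.single 1 1) := by
    rw [← add_assoc, ← Finsupp.single_add]
  have e2 : (Finsupp.single 0 2 + Finsupp.single 1 1 : Fin 2 →₀ ℕ) = Finsupp.single 1 1 + Finsupp.single 0 2 :=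
    add_comm _ _
  have h1 : coeff (Finsupp.single 0 2 + Finsupp.single 1 1) (X 0 * θ.b) =
      coeff (Finsupp.single 0 1 + Finsupp.single 1 1) θ.b := by rw [e1, coeff_add_single_X_mul]
  have h2 : coeff (Finsupp.single 0 2 + Finsupp.single 1 1) (X 1 * θ.a) = coeff (Finsupp.single 0 2) θ.a := by
    rw [e2, coeff_add_single_X_mul]
  rw [map_sub, h1, h2]

/-- `g₁₂ = b₀₂ − a₁₁` for `g = x·b − y·a`. [folklore] -/
theorem coeff_g_one_two (θ : PlanarField κ) :
    coeff (Finsupp.single 0 1 + Finsupp.single 1 2) (X 0 * θ.b - X 1 * θ.a) =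
      coeff (Finsupp.single 1 2) θ.b - coeff (Finsupp.single 0 1 + Finsupp.single 1 1) θ.a := by
  have e2 : (Finsupp.single 0 1 + Finsupp.single 1 2 : Fin 2 →₀ ℕ) =
      Finsupp.single 1 1 + (Finsupp.single 0 1 + Finsupp.single 1 1) := by
    rw [show (Finsupp.single (1 : Fin 2) 2 : Fin 2 →₀ ℕ) = Finsupp.single 1 1 + Finsupp.single 1 1 from
      by rw [← Finsupp.single_add], add_left_comm]
  have h1 : coeff (Finsupp.single 0 1 + Finsupp.single 1 2) (X 0 * θ.b) = coeff (Finsupp.single 1 2) θ.b := by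
    rw [coeff_add_single_X_mul]
  have h2 : coeff (Finsupp.single 0 1 + Finsupp.single 1 2) (X 1 * θ.a) =
      coeff (Finsupp.single 0 1 + Finsupp.single 1 1) θ.a := by rw [e2, coeff_add_single_X_mul]
  rw [map_sub, h1, h2]

/-- `g₀₃ = −a₀₂` for `g = x·b − y·a`. [folklore] -/
theorem coeff_g_zero_three (θ : PlanarField κ) :
    coeff (Finsupp.single 1 3) (X 0 * θ.b - X 1 * θ.a) = - coeff (Finsupp.single 1 2) θ.a := by
  rw [map_sub, coeff_X_mul_of_apply_eq_zero 0 (by simp) θ.b,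
    show (Finsupp.single (1 : Fin 2) 3 : Fin 2 →₀ ℕ) = Finsupp.single 1 1 + Finsupp.single 1 2 from
    by rw [← Finsupp.single_add], coeff_add_single_X_mul, zero_sub]

/-- `g₄₀ = b₃₀` for `g = x·b − y·a`. [folklore] -/
theorem coeff_g_four_zero (θ : PlanarField κ) :
    coeff (Finsupp.single 0 4) (X 0 * θ.b - X 1 * θ.a) = coeff (Finsupp.single 0 3) θ.b := by
  rw [map_sub, show (Finsupp.single (0 : Fin 2) 4 : Fin 2 →₀ ℕ) = Finsupp.single 0 1 + Finsupp.single 0 3 from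
    by rw [← Finsupp.single_add], coeff_add_single_X_mul,
    coeff_X_mul_of_apply_eq_zero 1 (by simp) θ.a, sub_zero]

/-! ### VII.2 Nakayama: jets bound colengths from above -/

/-- `x², xy, y² ∈ J ⇒ 𝔪² ≤ J`. [folklore] -/
theorem maximalIdeal_sq_le {J : Ideal (MvPowerSeries (Fin 2) κ)}
    (hxx : (X 0 ^ 2 : MvPowerSeries (Fin 2) κ) ∈ J) (hxy : (X 0 * X 1 : MvPowerSeries (Fin 2) κ) ∈ J)
    (hyy : (X 1 ^ 2 : MvPowerSeries (Fin 2) κ) ∈ J) : maximalIdeal (MvPowerSeries (Fin 2) κ) ^ 2 ≤ J := by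
  have hxx' : monomial (Finsupp.single 0 2) (1 : κ) ∈ J := by rwa [X_pow_eq] at hxx
  have hyy' : monomial (Finsupp.single 1 2) (1 : κ) ∈ J := by rwa [X_pow_eq] at hyy
  have hxy' : monomial (Finsupp.single 0 1 + Finsupp.single 1 1) (1 : κ) ∈ J := by
    rwa [X_def, X_def, monomial_mul_monomial, one_mul] at hxy
  rw [Literature.RingTheory.MvPowerSeries.Jets.maximalIdeal_pow_eq_span_monomial 2, Ideal.span_le]
  rintro _ ⟨e, he, rfl⟩
  obtain ⟨i, j, rfl⟩ : ∃ i j : ℕ, e = Finsupp.single 0 i + Finsupp.single 1 j :=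
    ⟨e 0, e 1, Literature.NumberTheory.EllipticCurves.finsupp_fin_two_eq e⟩
  replace he : i + j = 2 := by
    have := he; rw [Set.mem_setOf_eq, map_add, Finsupp.degree_single, Finsupp.degree_single] at this
    exact this
  have hi : i ≤ 2 := by omega
  have hj : j ≤ 2 := by omega
  interval_cases i <;> interval_cases j <;>
    first
      | omega
      | exact hxy'
      | (simp only [Finsupp.single_zero, zero_add, add_zero]; first | exact hxx' | exact hyy')

/-- NAKAYAMA: `𝔪² ≤ I + 𝔪³ ⇒ 𝔪² ≤ I`. [folklore] -/
theorem maximalIdeal_sq_le_of_le_sup {I : Ideal (MvPowerSeries (Fin 2) κ)}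
    (h : maximalIdeal (MvPowerSeries (Fin 2) κ) ^ 2 ≤ I ⊔ maximalIdeal (MvPowerSeries (Fin 2) κ) ^ 3) :
    maximalIdeal (MvPowerSeries (Fin 2) κ) ^ 2 ≤ I := by
  have hfg : (maximalIdeal (MvPowerSeries (Fin 2) κ) ^ 2).FG := by
    rw [Literature.RingTheory.MvPowerSeries.Jets.maximalIdeal_pow_eq_span_monomial 2]
    refine Submodule.fg_def.mpr ⟨_, ?_, rfl⟩
    exact ((Finsupp.finite_of_degree_lt (σ := Fin 2) 3).subset fun e (he : e.degree = 2) =>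
      show e.degree < 3 by rw [he]; norm_num).image _
  refine Submodule.le_of_le_smul_of_le_jacobson_bot (I := maximalIdeal (MvPowerSeries (Fin 2) κ)) hfg
    (IsLocalRing.maximalIdeal_le_jacobson _) ?_
  have h3 : maximalIdeal (MvPowerSeries (Fin 2) κ) • maximalIdeal (MvPowerSeries (Fin 2) κ) ^ 2 =
      maximalIdeal (MvPowerSeries (Fin 2) κ) ^ 3 := by
    rw [Ideal.smul_eq_mul, ← pow_succ']
  rw [h3]
  exact h

/-- The 1-jet remainder of a series lies in `𝔪²`. [folklore] -/
theorem sub_jet_one_mem_maximalIdeal_sq (f : MvPowerSeries (Fin 2) κ) :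
    f - C (constantCoeff f) - C (coeff (Finsupp.single 0 1) f) * X 0 - C (coeff (Finsupp.single 1 1) f) * X 1 ∈
      maximalIdeal (MvPowerSeries (Fin 2) κ) ^ 2 := by
  classical
  refine Literature.RingTheory.MvPowerSeries.Jets.mem_maximalIdeal_pow_of_le_order
    ((FormalCoordChange.two_le_order_iff _).mpr ⟨?_, fun i => ?_⟩)
  · simp
  · fin_cases i
    · show coeff (Finsupp.single 0 1) _ = 0
      simp [coeff_C_mul, coeff_index_single_X, coeff_C]
    · show coeff (Finsupp.single 1 1) _ = 0
      simp [coeff_C_mul, coeff_index_single_X, coeff_C]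

/-- If `𝔪² ≤ I` and `I` contains a series `ℓ` with `ℓ(0) = 0` and `∂ℓ/∂y (0) ≠ 0`, then `κ⟦x,y⟧/I` is
spanned by `1, x`, so has dimension `≤ 2`. [folklore] -/
theorem finrank_quot_le_two_of_sq_le {I : Ideal (MvPowerSeries (Fin 2) κ)}
    (hm2 : maximalIdeal (MvPowerSeries (Fin 2) κ) ^ 2 ≤ I) {ℓ : MvPowerSeries (Fin 2) κ} (hℓI : ℓ ∈ I)
    (hℓ0 : constantCoeff ℓ = 0) (hℓy : coeff (Finsupp.single 1 1) ℓ ≠ 0) :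
    Module.finrank κ (MvPowerSeries (Fin 2) κ ⧸ I) ≤ 2 := by
  classical
  -- `y` is a multiple of `x` modulo `I`
  have hy : Ideal.Quotient.mk I (X 1) ∈ Submodule.span κ
      ((({1, Ideal.Quotient.mk I (X 0)} : Finset (MvPowerSeries (Fin 2) κ ⧸ I)) :
        Set (MvPowerSeries (Fin 2) κ ⧸ I))) := by
    have hr := sub_jet_one_mem_maximalIdeal_sq ℓ
    rw [hℓ0, map_zero, sub_zero] at hr
    have h1 : C (coeff (Finsupp.single 1 1) ℓ) * X 1 - (-(C (coeff (Finsupp.single 0 1) ℓ) * X 0)) ∈ I := by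
      have : C (coeff (Finsupp.single 1 1) ℓ) * X 1 - (-(C (coeff (Finsupp.single 0 1) ℓ) * X 0)) =
          ℓ - (ℓ - C (coeff (Finsupp.single 0 1) ℓ) * X 0 - C (coeff (Finsupp.single 1 1) ℓ) * X 1) := by ring
      rw [this]
      exact Submodule.sub_mem _ hℓI (hm2 hr)
    have h2 : Ideal.Quotient.mk I (C (coeff (Finsupp.single 1 1) ℓ) * X 1) =
        Ideal.Quotient.mk I (-(C (coeff (Finsupp.single 0 1) ℓ) * X 0)) := (Ideal.Quotient.eq).mpr h1
    rw [map_mul, map_neg, map_mul, mk_C_eq_smul_one, mk_C_eq_smul_one, smul_mul_assoc, smul_mul_assoc, one_mul,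
      one_mul] at h2
    have h3 : Ideal.Quotient.mk I (X 1) =
        (coeff (Finsupp.single 1 1) ℓ)⁻¹ • (-(coeff (Finsupp.single 0 1) ℓ • Ideal.Quotient.mk I (X 0))) := by
      rw [← h2, inv_smul_smul₀ hℓy]
    rw [h3]
    exact Submodule.smul_mem _ _ (Submodule.neg_mem _ (Submodule.smul_mem _ _ (Submodule.subset_span (by simp))))
  have hspan : Submodule.span κ
      ((({1, Ideal.Quotient.mk I (X 0)} : Finset (MvPowerSeries (Fin 2) κ ⧸ I)) :
        Set (MvPowerSeries (Fin 2) κ ⧸ I))) = ⊤ := by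
    rw [eq_top_iff]
    rintro q -
    obtain ⟨f, rfl⟩ := Ideal.Quotient.mk_surjective q
    have hr := sub_jet_one_mem_maximalIdeal_sq f
    have hfI : f - (C (constantCoeff f) + C (coeff (Finsupp.single 0 1) f) * X 0
        + C (coeff (Finsupp.single 1 1) f) * X 1) ∈ I := by
      have : f - (C (constantCoeff f) + C (coeff (Finsupp.single 0 1) f) * X 0
          + C (coeff (Finsupp.single 1 1) f) * X 1) = f - C (constantCoeff f)
          - C (coeff (Finsupp.single 0 1) f) * X 0 - C (coeff (Finsupp.single 1 1) f) * X 1 := by ring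
      rw [this]
      exact hm2 hr
    rw [(Ideal.Quotient.eq).mpr hfI, map_add, map_add, map_mul, map_mul, mk_C_eq_smul_one, mk_C_eq_smul_one,
      mk_C_eq_smul_one, smul_mul_assoc, smul_mul_assoc, one_mul, one_mul]
    exact Submodule.add_mem _ (Submodule.add_mem _ (Submodule.smul_mem _ _ (Submodule.subset_span (by simp)))
      (Submodule.smul_mem _ _ (Submodule.subset_span (by simp)))) (Submodule.smul_mem _ _ hy)
  calc Module.finrank κ (MvPowerSeries (Fin 2) κ ⧸ I)
      = Module.finrank κ (⊤ : Submodule κ (MvPowerSeries (Fin 2) κ ⧸ I)) := by rw [finrank_top]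
    _ = Module.finrank κ (Submodule.span κ ((({1, Ideal.Quotient.mk I (X 0)} :
        Finset (MvPowerSeries (Fin 2) κ ⧸ I)) : Set (MvPowerSeries (Fin 2) κ ⧸ I)))) := by rw [hspan]
    _ ≤ ({1, Ideal.Quotient.mk I (X 0)} : Finset (MvPowerSeries (Fin 2) κ ⧸ I)).card :=
        finrank_span_finset_le_card _
    _ ≤ 2 := Finset.card_le_two

/-! ### VII.3 The cone is covariant: `HasTriple` under shear and swap -/

/-- `shear (-c)` undoes `shear c` on nodes. -/
theorem shear_neg_shear (c : κ) (θ : PlanarField κ) : shear (-c) (shear c θ) = θ := by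
  have hφ := hasSubst_shearVars (κ := κ) (-c)
  have hinv : ∀ f : MvPowerSeries (Fin 2) κ, subst (shearVars κ (-c)) (subst (shearVars κ c) f) = f := fun f => by
    have h := subst_shearVars_subst_shearVars_neg (-c) f
    rwa [neg_neg] at h
  obtain ⟨a, b⟩ := θ
  simp only [shear, PlanarField.mk.injEq]
  refine ⟨hinv a, ?_⟩
  rw [subst_sub hφ, subst_mul hφ, subst_C, hinv, hinv, map_neg]
  ring

/-- **Cone covariance (shear).** `HasTriple θ → HasTriple (shear c θ)`: the shear `φ_c` maps
`x·b − y·a` to the `g` of the sheared node and `(u x + v y)³` to `((u + v c) x + v y)³`. [OURS · L1 W4.5c] -/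
theorem hasTriple_shear (c : κ) (θ : PlanarField κ)
    (h : ∃ lam u v : κ, lam ≠ 0 ∧ (u ≠ 0 ∨ v ≠ 0) ∧
      X 0 * θ.b - X 1 * θ.a - C lam * (C u * X 0 + C v * X 1) ^ 3 ∈ maximalIdeal (MvPowerSeries (Fin 2) κ) ^ 4) :
    ∃ lam u v : κ, lam ≠ 0 ∧ (u ≠ 0 ∨ v ≠ 0) ∧
      X 0 * (shear c θ).b - X 1 * (shear c θ).a - C lam * (C u * X 0 + C v * X 1) ^ 3 ∈
        maximalIdeal (MvPowerSeries (Fin 2) κ) ^ 4 := by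
  obtain ⟨lam, u, v, hlam, huv, hmem⟩ := h
  have hφ := hasSubst_shearVars (κ := κ) c
  refine ⟨lam, u + v * c, v, hlam, ?_, ?_⟩
  · by_cases hv : v = 0
    · left
      rw [hv, zero_mul, add_zero]
      rcases huv with hu | hv'
      · exact hu
      · exact absurd hv hv'
    · exact Or.inr hv
  · have key : X 0 * (shear c θ).b - X 1 * (shear c θ).a - C lam * (C (u + v * c) * X 0 + C v * X 1) ^ 3 =
        subst (shearVars κ c) (X 0 * θ.b - X 1 * θ.a - C lam * (C u * X 0 + C v * X 1) ^ 3) := by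
      rw [shear_a, shear_b]
      simp only [subst_sub hφ, subst_mul hφ, subst_add hφ, subst_pow hφ, subst_C, subst_shearVars_X_zero,
        subst_shearVars_X_one, map_add, map_mul]
      ring
    have h1 := Literature.RingTheory.MvPowerSeries.Jets.algHom_apply_mem_maximalIdeal_pow (substAlgHom hφ) hmem
    rw [substAlgHom_apply] at h1
    rw [key]
    exact h1

/-- **Cone covariance (swap).** `HasTriple θ → HasTriple (swapField θ)` (`g ↦ −g∘s`). [OURS · L1 W4.5c] -/
theorem hasTriple_swapField (θ : PlanarField κ)
    (h : ∃ lam u v : κ, lam ≠ 0 ∧ (u ≠ 0 ∨ v ≠ 0) ∧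
      X 0 * θ.b - X 1 * θ.a - C lam * (C u * X 0 + C v * X 1) ^ 3 ∈ maximalIdeal (MvPowerSeries (Fin 2) κ) ^ 4) :
    ∃ lam u v : κ, lam ≠ 0 ∧ (u ≠ 0 ∨ v ≠ 0) ∧
      X 0 * (swapField θ).b - X 1 * (swapField θ).a - C lam * (C u * X 0 + C v * X 1) ^ 3 ∈
        maximalIdeal (MvPowerSeries (Fin 2) κ) ^ 4 := by
  obtain ⟨lam, u, v, hlam, huv, hmem⟩ := h
  have hψ := hasSubst_swapVars (κ := κ)
  refine ⟨-lam, v, u, neg_ne_zero.mpr hlam, huv.symm, ?_⟩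
  have key : X 0 * (swapField θ).b - X 1 * (swapField θ).a - C (-lam) * (C v * X 0 + C u * X 1) ^ 3 =
      -(subst (swapVars κ) (X 0 * θ.b - X 1 * θ.a - C lam * (C u * X 0 + C v * X 1) ^ 3)) := by
    rw [swapField_a, swapField_b]
    simp only [subst_sub hψ, subst_mul hψ, subst_add hψ, subst_pow hψ, subst_C, subst_swapVars_X_zero,
      subst_swapVars_X_one, map_neg]
    ring
  have h1 := Literature.RingTheory.MvPowerSeries.Jets.algHom_apply_mem_maximalIdeal_pow (substAlgHom hψ) hmem
  rw [substAlgHom_apply] at h1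
  rw [key]
  exact neg_mem h1

/-- `HasTriple` is invariant under the shear. [OURS · L1 W4.5c] -/
theorem hasTriple_shear_iff (c : κ) (θ : PlanarField κ) :
    (∃ lam u v : κ, lam ≠ 0 ∧ (u ≠ 0 ∨ v ≠ 0) ∧
      X 0 * (shear c θ).b - X 1 * (shear c θ).a - C lam * (C u * X 0 + C v * X 1) ^ 3 ∈
        maximalIdeal (MvPowerSeries (Fin 2) κ) ^ 4) ↔
    ∃ lam u v : κ, lam ≠ 0 ∧ (u ≠ 0 ∨ v ≠ 0) ∧
      X 0 * θ.b - X 1 * θ.a - C lam * (C u * X 0 + C v * X 1) ^ 3 ∈ maximalIdeal (MvPowerSeries (Fin 2) κ) ^ 4 :=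
  ⟨fun h => by simpa only [shear_neg_shear] using hasTriple_shear (-c) (shear c θ) h, hasTriple_shear c θ⟩

/-- `HasTriple` is invariant under the swap. [OURS · L1 W4.5c] -/
theorem hasTriple_swapField_iff (θ : PlanarField κ) :
    (∃ lam u v : κ, lam ≠ 0 ∧ (u ≠ 0 ∨ v ≠ 0) ∧
      X 0 * (swapField θ).b - X 1 * (swapField θ).a - C lam * (C u * X 0 + C v * X 1) ^ 3 ∈
        maximalIdeal (MvPowerSeries (Fin 2) κ) ^ 4) ↔
    ∃ lam u v : κ, lam ≠ 0 ∧ (u ≠ 0 ∨ v ≠ 0) ∧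
      X 0 * θ.b - X 1 * θ.a - C lam * (C u * X 0 + C v * X 1) ^ 3 ∈ maximalIdeal (MvPowerSeries (Fin 2) κ) ^ 4 :=
  ⟨fun h => by simpa only [swapField_swapField] using hasTriple_swapField (swapField θ) h, hasTriple_swapField θ⟩

end Summit.ResolutionOfSingularities.ResolutionOfSingularities.Theorems.WildQuotientResolution.S1.PlanarField

end
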